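import Literature.AlgebraicGeometry.Frobenioids.PadicKummerRemark221Coprime
import HarnessLib

/-!
# Frobenioids II, Remark 2.2.1: the Hilbert-90 INJECTION `H¹(H_A, μ_N(O^□_L)) ↪ (Eˣ ∩ Lˣᴺ)/Eˣᴺ` bounding `H¹(H_A, μ_N(A))` above

Mochizuki, *The geometry of Frobenioids II*, Kyushu J. Math. **62** (2008) 401–460, §2, Remark 2.2.1
p. 18 [cite: MochizukiFrdII2008, Rmk 2.2.1 p.18]: "… by translating into extension field-theoretic
language the Galois cohomological conditions of Definition 2.2 (ii) (c) … any element `f ∈ O^□(A)^H`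
admits an `N`-th root `g ∈ O^□(A)`".

PROOF-ONLY companion (second of two; the first is `PadicKummerRemark221KummerInjection.lean`), abc-iut
cell, D-0079 L-F [FrdI/II], GAP-2R on FACT-LIST row F-1198 `SaturatedInvariantsAdmitRoots` (GENERAL `N`):

* **Hilbert-90 injection (above `H¹(H_A, μ_N(A))`).** For a finite `L/K` inside `K̄`, a
  `Gal(L/K)`-stable submonoid `O^□_L ⊆ L` containing the `N`-th roots of unity of `L`, any
  `H_A ≤ Gal(L/K)` with fixed field `E = L^{H_A}`: `H¹(H_A, μ_N(O^□_L)) ↪ (Eˣ ∩ Lˣᴺ)/Eˣᴺ`,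
  `[c] ↦ [yᴺ]` where `c(h) = h(y)/y` (Mathlib's Noether–Hilbert 90
  `isMulCoboundary₁_of_isMulCocycle₁_of_aut_to_units` for `L/E`; `exists_units_forall_apply_eq_mul`,
  `exists_injective_h1_to_unitsQuot`). Here `H¹` is Mathlib's continuous cohomology of the discrete
  `H_A` (`Kummer.muTopRep`, the carrier of Def. 2.2 (ii)(c)).

Consumer: `PadicKummerRemark221General.lean` (the chain of inequalities closing F-1198 for general `N`).
Nothing here concerns [IUTchIII]; classical Hilbert 90. Universe `0` (as the parents).
-/

noncomputable section

namespace Literature.AlgebraicGeometry.Frobenioids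

namespace PadicKummer

namespace Def22Context

open Field IntermediateField
open Literature.NumberTheory.GaloisRepresentations
open Literature.NumberTheory.GaloisRepresentations.LocalWeilDatum
open Literature.NumberTheory.GaloisRepresentations.DiscreteGaloisModule

/-! ### The Hilbert-90 injection `H¹(H_A, μ_N(O^□_L)) ↪ (Eˣ ∩ Lˣᴺ)/Eˣᴺ` -/

section Hilbert90

/- The topology on `Gal(L/K)` is an IMPLICIT binder (read off the types at the use site: for the
context `ofLocalField L H hH S` it is the discrete `Def22Context.instTopologicalSpaceAutE`, not
Mathlib's Krull instance) — see the note on topologies in `PadicKummerGaloisFN.lean`. Elements of the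
coefficient module `Kummer.muTopRep N O^□_L H_A` (carrier `Additive μ_N(O^□_L)`) are read in `L` through
`Kummer.Mu.val` with the `Additive.toMul` identification pinned at `μ_N(O^□_L)`. -/
variable {K : Type} [Field K] {L : IntermediateField K (AlgebraicClosure K)} [FiniteDimensional K L]
  (S : StableSubmonoid L) {tΓ : TopologicalSpace (L ≃ₐ[K] L)} {dΓ : DiscreteTopology (L ≃ₐ[K] L)}
  (HA : Subgroup (L ≃ₐ[K] L)) (N : ℕ)

omit [FiniteDimensional K L] in
/-- The value in `L` determines the element of the coefficient module `μ_N(O^□_L)`.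
[cite: MochizukiFrdII2008, Def 2.1 (i) p.16] -/
private theorem val_injective : Function.Injective fun y : Kummer.muTopRep N (GalMonoid S) HA =>
    ((Kummer.Mu.val (Additive.toMul (α := Kummer.Mu N (GalMonoid S)) y) : (GalMonoid S)ˣ) : GalMonoid S).val := by
  intro y y' h
  exact Additive.toMul.injective (Kummer.Mu.ext (Units.ext (GalMonoid.ext h)))

omit [FiniteDimensional K L] in
/-- The value in `L` of a sum in `μ_N(O^□_L)` (additive notation) is the product of the values.
[cite: MochizukiFrdII2008, Def 2.1 (i) p.16] -/
private theorem val_add (x x' : Kummer.muTopRep N (GalMonoid S) HA) :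
    ((Kummer.Mu.val (Additive.toMul (α := Kummer.Mu N (GalMonoid S)) (x + x')) : (GalMonoid S)ˣ) : GalMonoid S).val = ((Kummer.Mu.val (Additive.toMul (α := Kummer.Mu N (GalMonoid S)) x) : (GalMonoid S)ˣ) : GalMonoid S).val * ((Kummer.Mu.val (Additive.toMul (α := Kummer.Mu N (GalMonoid S)) x') : (GalMonoid S)ˣ) : GalMonoid S).val := rfl

omit [FiniteDimensional K L] in
/-- The value in `L` of a difference is the quotient of the values. [cite: MochizukiFrdII2008, Def 2.1 (i) p.16] -/
private theorem val_sub (x x' : Kummer.muTopRep N (GalMonoid S) HA) :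
    ((Kummer.Mu.val (Additive.toMul (α := Kummer.Mu N (GalMonoid S)) (x - x')) : (GalMonoid S)ˣ) : GalMonoid S).val = ((Kummer.Mu.val (Additive.toMul (α := Kummer.Mu N (GalMonoid S)) x) : (GalMonoid S)ˣ) : GalMonoid S).val / ((Kummer.Mu.val (Additive.toMul (α := Kummer.Mu N (GalMonoid S)) x') : (GalMonoid S)ˣ) : GalMonoid S).val := by
  rw [eq_div_iff (GalMonoid.val_ne_zero _), ← val_add, sub_add_cancel]

omit [FiniteDimensional K L] in
/-- Values in `L` of elements of `μ_N(O^□_L)` are `N`-th roots of unity. [cite: MochizukiFrdII2008, Def 2.1 (i) p.16] -/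
private theorem val_pow (x : Kummer.muTopRep N (GalMonoid S) HA) : (((Kummer.Mu.val (Additive.toMul (α := Kummer.Mu N (GalMonoid S)) x) : (GalMonoid S)ˣ) : GalMonoid S).val) ^ N = 1 := by
  rw [← GalMonoid.val_pow, ← Units.val_pow_eq_pow_val,
    (mem_rootsOfUnity N _).mp (Kummer.Mu.val_mem _), Units.val_one, GalMonoid.val_one]

omit [FiniteDimensional K L] in
/-- The action of `H_A` on the coefficient module is the action on `μ_N(O^□_L)` (unfolding
`Kummer.muTopRep`). [cite: MochizukiFrdII2008, Def 2.2 (ii) p.17] -/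
private theorem ρ_apply (h : HA) (x : Kummer.muTopRep N (GalMonoid S) HA) :
    (Kummer.muTopRep N (GalMonoid S) HA).ρ h x =
      (Additive.ofMul (h • Additive.toMul (α := Kummer.Mu N (GalMonoid S)) x) :
        Additive (Kummer.Mu N (GalMonoid S))) := rfl

omit [FiniteDimensional K L] in
/-- The action of `h ∈ H_A ≤ Gal(L/K)` on `μ_N(O^□_L)`, read in `L`, is `h` itself.
[cite: MochizukiFrdII2008, Def 2.2 (ii) p.17] -/
private theorem val_smul_mu (h : HA) (z : Kummer.Mu N (GalMonoid S)) :
    (((h • z).val : (GalMonoid S)ˣ) : GalMonoid S).val =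
      (h : L ≃ₐ[K] L) ((z.val : (GalMonoid S)ˣ) : GalMonoid S).val := by
  simp only [Subgroup.smul_def, Kummer.Mu.val_smul, Kummer.coe_unitsAct, GalMonoid.val_smul,
    AlgEquiv.smul_def]

omit [FiniteDimensional K L] in
/-- `H_A` acts on the coefficient module `μ_N(O^□_L)` through its action on `L`: the value of `h • x`
is `h` applied to the value of `x`. [cite: MochizukiFrdII2008, Def 2.2 (ii) p.17] -/
private theorem val_ρ (h : HA) (x : Kummer.muTopRep N (GalMonoid S) HA) :
    ((Kummer.Mu.val (Additive.toMul (α := Kummer.Mu N (GalMonoid S))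
        ((Kummer.muTopRep N (GalMonoid S) HA).ρ h x)) : (GalMonoid S)ˣ) : GalMonoid S).val =
      (h : L ≃ₐ[K] L) (((Kummer.Mu.val (Additive.toMul (α := Kummer.Mu N (GalMonoid S)) x)) :
        (GalMonoid S)ˣ) : GalMonoid S).val := by
  rw [ρ_apply, toMul_ofMul, val_smul_mu]

set_option maxHeartbeats 400000 in
/-- For a continuous crossed homomorphism `φ : H_A → μ_N(O^□_L)` there is `y ∈ Lˣ` with
`h(y) = φ(h) · y` in `L` for all `h ∈ H_A` — Noether–Hilbert 90 for the finite extension `L / L^{H_A}`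
(Mathlib `isMulCoboundary₁_of_isMulCocycle₁_of_aut_to_units`, the automorphisms of `L/L^{H_A}` mapping
onto `H_A = Gal(L/L^{H_A})`, `fixingSubgroup_fixedField`). [cite: MochizukiFrdII2008, Rmk 2.2.1 p.18] -/
theorem exists_units_forall_apply_eq_mul
    (φ : contOneCocycles (Kummer.muTopRep N (GalMonoid S) HA)) :
    ∃ y : Lˣ, ∀ h : HA, (h : L ≃ₐ[K] L) (y : L) = ((Kummer.Mu.val (Additive.toMul (α := Kummer.Mu N (GalMonoid S)) (φ.1 h)) : (GalMonoid S)ˣ) : GalMonoid S).val * (y : L) := by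
  classical
  -- the action of `Gal(L/L^{H_A})` on `Lˣ` (instance path pinned locally; cf. `AlgEquiv.smul_units_def`)
  letI i1 : MulDistribMulAction (L ≃ₐ[fixedField HA] L) Lˣ := AlgEquiv.instMulDistribMulActionUnits
  letI i2 : MulAction (L ≃ₐ[fixedField HA] L) Lˣ := i1.toMulAction
  letI i3 : SMul (L ≃ₐ[fixedField HA] L) Lˣ := i2.toSMul
  -- `Gal(L/E) → H_A`, `E = L^{H_A}` (kept opaque: only its two properties are used)
  have hmem : ∀ ψ : L ≃ₐ[fixedField HA] L, ψ.restrictScalars K ∈ HA := fun ψ => by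
    have h1 : ψ.restrictScalars K ∈ fixingSubgroup (fixedField HA) := fun x => ψ.commutes x
    rwa [fixingSubgroup_fixedField HA] at h1
  obtain ⟨toHA, toHA_apply, toHA_mul⟩ :
      ∃ t : (L ≃ₐ[fixedField HA] L) → HA,
        (∀ (ψ : L ≃ₐ[fixedField HA] L) (z : L), (t ψ : L ≃ₐ[K] L) z = ψ z) ∧
          ∀ ψ ψ' : L ≃ₐ[fixedField HA] L, t (ψ * ψ') = t ψ * t ψ' :=
    ⟨fun ψ => ⟨ψ.restrictScalars K, hmem ψ⟩, fun ψ z => rfl,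
      fun ψ ψ' => Subtype.ext (AlgEquiv.ext fun x => rfl)⟩
  -- the multiplicative cocycle `ψ ↦ φ(ψ|_K)` with values in `Lˣ`
  let f : (L ≃ₐ[fixedField HA] L) → Lˣ := fun ψ =>
    Units.mk0 (((Kummer.Mu.val (Additive.toMul (α := Kummer.Mu N (GalMonoid S)) (φ.1 (toHA ψ))) : (GalMonoid S)ˣ) : GalMonoid S).val) (GalMonoid.val_ne_zero _)
  have hf_val : ∀ ψ, (f ψ : L) = ((Kummer.Mu.val (Additive.toMul (α := Kummer.Mu N (GalMonoid S)) (φ.1 (toHA ψ))) : (GalMonoid S)ˣ) : GalMonoid S).val := fun ψ => rfl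
  have hf : groupCohomology.IsMulCocycle₁ f := by
    intro ψ ψ'
    apply Units.ext
    have hsm : ((ψ • f ψ' : Lˣ) : L) = ψ (f ψ' : L) := by
      rw [AlgEquiv.smul_units_def, Units.coe_map, MonoidHom.coe_coe]
    calc (f (ψ * ψ') : L) = ((Kummer.Mu.val (Additive.toMul (α := Kummer.Mu N (GalMonoid S)) (φ.1 (toHA (ψ * ψ')))) : (GalMonoid S)ˣ) : GalMonoid S).val := hf_val _
      _ = ((Kummer.Mu.val (Additive.toMul (α := Kummer.Mu N (GalMonoid S)) (φ.1 (toHA ψ * toHA ψ'))) : (GalMonoid S)ˣ) : GalMonoid S).val :=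
          congrArg (fun g : HA => ((Kummer.Mu.val (Additive.toMul (α := Kummer.Mu N (GalMonoid S)) (φ.1 g)) : (GalMonoid S)ˣ) : GalMonoid S).val) (toHA_mul ψ ψ')
      _ = ((Kummer.Mu.val (Additive.toMul (α := Kummer.Mu N (GalMonoid S)) (φ.1 (toHA ψ) + (Kummer.muTopRep N (GalMonoid S) HA).ρ (toHA ψ) (φ.1 (toHA ψ')))) : (GalMonoid S)ˣ) : GalMonoid S).val :=
          congrArg (fun z : Kummer.muTopRep N (GalMonoid S) HA => ((Kummer.Mu.val (Additive.toMul (α := Kummer.Mu N (GalMonoid S)) z) : (GalMonoid S)ˣ) : GalMonoid S).val) (φ.2 _ _)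
      _ = ((Kummer.Mu.val (Additive.toMul (α := Kummer.Mu N (GalMonoid S)) (φ.1 (toHA ψ))) : (GalMonoid S)ˣ) : GalMonoid S).val *
            ((Kummer.Mu.val (Additive.toMul (α := Kummer.Mu N (GalMonoid S)) ((Kummer.muTopRep N (GalMonoid S) HA).ρ (toHA ψ) (φ.1 (toHA ψ')))) : (GalMonoid S)ˣ) : GalMonoid S).val :=
          val_add S HA N _ _
      _ = ((Kummer.Mu.val (Additive.toMul (α := Kummer.Mu N (GalMonoid S)) (φ.1 (toHA ψ))) : (GalMonoid S)ˣ) : GalMonoid S).val * (toHA ψ : L ≃ₐ[K] L) (((Kummer.Mu.val (Additive.toMul (α := Kummer.Mu N (GalMonoid S)) (φ.1 (toHA ψ'))) : (GalMonoid S)ˣ) : GalMonoid S).val) := by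
          rw [val_ρ]
      _ = ((Kummer.Mu.val (Additive.toMul (α := Kummer.Mu N (GalMonoid S)) (φ.1 (toHA ψ))) : (GalMonoid S)ˣ) : GalMonoid S).val * ψ (((Kummer.Mu.val (Additive.toMul (α := Kummer.Mu N (GalMonoid S)) (φ.1 (toHA ψ'))) : (GalMonoid S)ˣ) : GalMonoid S).val) :=
          congrArg (fun t : L => ((Kummer.Mu.val (Additive.toMul (α := Kummer.Mu N (GalMonoid S)) (φ.1 (toHA ψ))) : (GalMonoid S)ˣ) : GalMonoid S).val * t) (toHA_apply ψ _)
      _ = ψ (f ψ' : L) * (f ψ : L) := mul_comm _ _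
      _ = ((ψ • f ψ' : Lˣ) : L) * (f ψ : L) := congrArg (fun t : L => t * (f ψ : L)) hsm.symm
      _ = ((ψ • f ψ' * f ψ : Lˣ) : L) := (Units.val_mul _ _).symm
  have key := groupCohomology.isMulCoboundary₁_of_isMulCocycle₁_of_aut_to_units f hf
  clear_value f
  obtain ⟨y, hy⟩ := key
  refine ⟨y, fun h => ?_⟩
  -- `h` as an automorphism of `L / L^{H_A}`
  let ψ : L ≃ₐ[fixedField HA] L :=
    { (h : L ≃ₐ[K] L).toRingEquiv with
      commutes' := fun x => (mem_fixedField_iff HA (x : L)).mp x.2 (h : L ≃ₐ[K] L) h.2 }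
  have hψ : toHA ψ = h := Subtype.ext (AlgEquiv.ext fun z => (toHA_apply ψ z).trans rfl)
  have h1 := hy ψ
  rw [div_eq_iff_eq_mul, AlgEquiv.smul_units_def] at h1
  have h2 := congrArg (fun z : Lˣ => (z : L)) h1
  simp only [Units.val_mul, Units.coe_map, MonoidHom.coe_coe, hf_val, hψ] at h2
  exact h2

/-- **The Hilbert-90 injection.** For a finite extension `L/K` inside `K̄`, a `Gal(L/K)`-stable
submonoid `O^□_L` of `L` containing the `N`-th roots of unity of `L`, a subgroup `H_A ≤ Gal(L/K)` with
fixed field `E = L^{H_A}`: there is an INJECTIVE map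
`H¹(H_A, μ_N(O^□_L)) ↪ (Eˣ ∩ Lˣᴺ)/Eˣᴺ`, `[h ↦ h(y)/y] ↦ [yᴺ]` — the target being the quotient of
`Q = {e ∈ Eˣ | e ∈ Lˣᴺ}` (units of `E` that are `N`-th powers in `L`) by `Eˣᴺ`. (Injectivity:
`y'ᴺ = yᴺeᴺ` with `e ∈ Eˣ` makes `ζ = y'/(ye)` an `N`-th root of unity of `L`, in `O^□_L`, and
`h(y')/y' = (h(y)/y) · (h(ζ)/ζ)`: the two cocycles differ by the coboundary of `ζ`.)
[cite: MochizukiFrdII2008, Rmk 2.2.1 p.18] -/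
theorem exists_injective_h1_to_unitsQuot (hS : ∀ x : L, x ^ N = 1 → x ∈ S.toSubmonoid) :
    ∃ g : (continuousCohomology 1 (Kummer.muTopRep N (GalMonoid S) HA) : TopModuleCat ℤ) →
        ↥(((powMonoidHom N : Lˣ →* Lˣ).range).comap
            (Units.map (algebraMap (fixedField HA) L).toMonoidHom)) ⧸
          ((powMonoidHom N : (fixedField HA)ˣ →* (fixedField HA)ˣ).range).subgroupOf
            (((powMonoidHom N : Lˣ →* Lˣ).range).comap
              (Units.map (algebraMap (fixedField HA) L).toMonoidHom)),
      Function.Injective g := by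
  classical
  -- notation (opaque abbreviations with their defining equations)
  set ιE : (fixedField HA)ˣ →* Lˣ := Units.map (algebraMap (fixedField HA) L).toMonoidHom with hιE_def
  have hιE_val : ∀ e : (fixedField HA)ˣ, ((ιE e : Lˣ) : L) = ((e : fixedField HA) : L) := fun e => by
    rw [hιE_def]; rfl
  clear_value ιE
  set PE : Subgroup (fixedField HA)ˣ := (powMonoidHom N : (fixedField HA)ˣ →* (fixedField HA)ˣ).range
    with hPE_def
  set Q : Subgroup (fixedField HA)ˣ := ((powMonoidHom N : Lˣ →* Lˣ).range).comap ιE with hQ_def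
  clear_value PE Q
  -- Step 1: Hilbert 90 for each cocycle, and `y^N ∈ E`
  have step : ∀ φ : contOneCocycles (Kummer.muTopRep N (GalMonoid S) HA),
      ∃ y : Lˣ, ∃ q : Q, ιE (q : (fixedField HA)ˣ) = y ^ N ∧
        ∀ h : HA, ((Kummer.Mu.val (Additive.toMul (α := Kummer.Mu N (GalMonoid S)) (φ.1 h)) : (GalMonoid S)ˣ) : GalMonoid S).val = (h : L ≃ₐ[K] L) (y : L) / (y : L) := by
    intro φ
    obtain ⟨y, hy⟩ := exists_units_forall_apply_eq_mul S HA N φ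
    have hy' : ∀ h : HA, ((Kummer.Mu.val (Additive.toMul (α := Kummer.Mu N (GalMonoid S)) (φ.1 h)) : (GalMonoid S)ˣ) : GalMonoid S).val = (h : L ≃ₐ[K] L) (y : L) / (y : L) := fun h => by
      rw [eq_div_iff y.ne_zero, hy h]
    have hyNE : ((y : L) ^ N) ∈ fixedField HA := by
      rw [mem_fixedField_iff]
      intro h hh
      rw [map_pow, hy ⟨h, hh⟩, mul_pow, val_pow, one_mul]
    have hyN0 : (⟨(y : L) ^ N, hyNE⟩ : fixedField HA) ≠ 0 := fun h =>
      pow_ne_zero N y.ne_zero (congrArg Subtype.val h)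
    obtain ⟨e, he⟩ : ∃ e : (fixedField HA)ˣ, ιE e = y ^ N :=
      ⟨Units.mk0 _ hyN0, Units.ext (by rw [hιE_val, Units.val_pow_eq_pow_val]; rfl)⟩
    have heQ : e ∈ Q := by
      rw [hQ_def, Subgroup.mem_comap, he]
      exact ⟨y, rfl⟩
    exact ⟨y, ⟨e, heQ⟩, he, hy'⟩
  choose yφ qφ hqφ hyφ using step
  -- Step 2: the map, through chosen representing cocycles
  have hsurj := oneCocycleClass_surjective (Kummer.muTopRep N (GalMonoid S) HA)
  choose lift hlift using hsurj
  refine ⟨fun c => (QuotientGroup.mk (qφ (lift c)) : Q ⧸ PE.subgroupOf Q), fun c c' hcc' => ?_⟩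
  -- Step 3: injectivity
  have hcc : ((qφ (lift c))⁻¹ * qφ (lift c') : Q) ∈ PE.subgroupOf Q := QuotientGroup.eq.mp hcc'
  rw [Subgroup.mem_subgroupOf, Subgroup.coe_mul, Subgroup.coe_inv, hPE_def, MonoidHom.mem_range] at hcc
  obtain ⟨e, he⟩ := hcc
  rw [powMonoidHom_apply, eq_inv_mul_iff_mul_eq] at he
  -- `y'^N = y^N · e^N`, so `ζ := y'/(y e)` is an `N`-th root of unity of `L`
  have hpow : yφ (lift c') ^ N = yφ (lift c) ^ N * (ιE e) ^ N := by
    rw [← hqφ (lift c), ← hqφ (lift c'), ← map_pow, ← map_mul, he]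
  obtain ⟨ζu, hζu⟩ : ∃ ζu : Lˣ, ζu = yφ (lift c') / (yφ (lift c) * ιE e) := ⟨_, rfl⟩
  have hζ : ζu ^ N = 1 := by rw [hζu, div_pow, mul_pow, ← hpow, div_self']
  have hζL : ((ζu : L)) ^ N = 1 := by rw [← Units.val_pow_eq_pow_val, hζ, Units.val_one]
  have hζL' : ((ζu⁻¹ : Lˣ) : L) ^ N = 1 := by
    rw [← Units.val_pow_eq_pow_val, inv_pow, hζ, inv_one, Units.val_one]
  have hζS : (ζu : L) ∈ S.toSubmonoid := hS _ hζL
  have hζS' : ((ζu⁻¹ : Lˣ) : L) ∈ S.toSubmonoid := hS _ hζL'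
  have hζval : (ζu : L) = (yφ (lift c') : L) / ((yφ (lift c) : L) * ((ιE e : Lˣ) : L)) := by
    rw [hζu, Units.val_div_eq_div_val, Units.val_mul]
  -- `ζ` as an element of `μ_N(O^□_L)`: a coboundary witness `v` with value `ζ`
  obtain ⟨v, hv_val⟩ : ∃ v : Kummer.muTopRep N (GalMonoid S) HA, ((Kummer.Mu.val (Additive.toMul (α := Kummer.Mu N (GalMonoid S)) v) : (GalMonoid S)ˣ) : GalMonoid S).val = (ζu : L) := by
    let zO : (GalMonoid S)ˣ :=
      ⟨GalMonoid.mk _ hζS, GalMonoid.mk _ hζS',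
        GalMonoid.ext (by rw [GalMonoid.val_mul, GalMonoid.val_mk, GalMonoid.val_mk, ← Units.val_mul,
          mul_inv_cancel, Units.val_one, GalMonoid.val_one]),
        GalMonoid.ext (by rw [GalMonoid.val_mul, GalMonoid.val_mk, GalMonoid.val_mk, ← Units.val_mul,
          inv_mul_cancel, Units.val_one, GalMonoid.val_one])⟩
    have hzO_val : (zO : GalMonoid S).val = (ζu : L) := rfl
    have hzO : zO ∈ rootsOfUnity N (GalMonoid S) := by
      rw [mem_rootsOfUnity]
      apply Units.ext
      apply GalMonoid.ext
      rw [Units.val_pow_eq_pow_val, GalMonoid.val_pow, hzO_val, hζL, Units.val_one, GalMonoid.val_one]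
    exact ⟨(Additive.ofMul (Kummer.Mu.mk zO hzO) : Additive (Kummer.Mu N (GalMonoid S))), hzO_val⟩
  -- the two representing cocycles differ by the coboundary of `ζ`
  have hy0 : (yφ (lift c) : L) ≠ 0 := (yφ (lift c)).ne_zero
  have hy'0 : (yφ (lift c') : L) ≠ 0 := (yφ (lift c')).ne_zero
  have he0 : ((ιE e : Lˣ) : L) ≠ 0 := (ιE e).ne_zero
  have he_fix : ∀ h : HA, (h : L ≃ₐ[K] L) ((ιE e : Lˣ) : L) = ((ιE e : Lˣ) : L) := fun h => by
    rw [hιE_val]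
    exact (mem_fixedField_iff HA _).mp (e : fixedField HA).2 (h : L ≃ₐ[K] L) h.2
  have hdiff : oneCocycleClass _ (lift c') = oneCocycleClass _ (lift c) := by
    rw [← sub_eq_zero, ← oneCocycleClass_sub, oneCocycleClass_eq_zero_iff]
    refine ⟨v, fun h => ?_⟩
    -- compare values in `L`
    apply val_injective S HA N
    change ((Kummer.Mu.val (Additive.toMul (α := Kummer.Mu N (GalMonoid S)) (((lift c') - (lift c) : contOneCocycles (Kummer.muTopRep N (GalMonoid S) HA)).1 h)) : (GalMonoid S)ˣ) : GalMonoid S).val =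
      ((Kummer.Mu.val (Additive.toMul (α := Kummer.Mu N (GalMonoid S)) ((Kummer.muTopRep N (GalMonoid S) HA).ρ h v - v)) : (GalMonoid S)ˣ) : GalMonoid S).val
    simp only [Submodule.coe_sub, ContinuousMap.sub_apply, val_sub, val_ρ, hv_val]
    -- `φ' h = h(y')/y'`, `φ h = h(y)/y` (`hyφ`), `ζ = y'/(y e)`, `h e = e`
    simp only [hyφ, hζval, map_div₀, map_mul, he_fix]
    have hhy0 : (h : L ≃ₐ[K] L) (yφ (lift c) : L) ≠ 0 := by
      rw [Ne, map_eq_zero_iff _ (h : L ≃ₐ[K] L).injective]; exact hy0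
    have hhy'0 : (h : L ≃ₐ[K] L) (yφ (lift c') : L) ≠ 0 := by
      rw [Ne, map_eq_zero_iff _ (h : L ≃ₐ[K] L).injective]; exact hy'0
    field_simp
  -- conclude `c = c'`
  rw [← hlift c, ← hlift c']
  exact hdiff.symm

end Hilbert90

end Def22Context

end PadicKummer

end Literature.AlgebraicGeometry.Frobenioids

end
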